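import Summits.AtomisticToContinuum.FouriersLaw.Theses.MatthiessenLadder
import Summits.AtomisticToContinuum.FouriersLaw.Theorems.OddSectorIrreversibilityBoundedResponseConvergesStubPositiveConductanceAux2
import Summits.AtomisticToContinuum.FouriersLaw.Theorems.MatthiessenLadderPrefixSteadyStatesStubSteadyStateOfSemigroupBound
import Literature.MathematicalPhysics.KineticTheory.SiteChainHormander

/-!
# Stub `stub_cellChainTapEnergyPos` of line `registered`
# (crux stmt-AtomisticToContinuum-12776, `MatthiessenLadder.PrefixIncrementBounds`)

**Strictly positive tap energy of the Kubo corrector of a cell chain** (any profile `c`, `β ≥ 0`,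
`N ≥ 2`): the first-integral rigidity argument of the homogeneous `pinnedChain`
(`OddSectorIrreversibilityBoundedResponseConvergesStubPositiveConductanceAux1/2.lean`) redone for the
SITE-DEPENDENT potentials of `SiteChain`. Generic part (smooth potentials): `∂_{q_x} ∂Φ/∂q_k = ∂²Φ/∂q_x∂q_k`
(`SiteChain.d2Potential`: tridiagonal, sub-diagonal `-V_k''`); for the energy first moment
`X = Σ_k k·e_k` (an explicit function fixed by the hypothesis `hX`) `∂_{p_i}X = i p_i` and
`{H, X} = J_tot`; silent contact derivatives reduce `L` to `{H, ·}`; the Jacobi recursions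
(B) `∂_{p_k}w ≡ 0 ⇒ ∂_{q_k}w ≡ 0`, (A) `V_k''·∂_{p_{k+1}}w = {w, {H, p_k}} ≡ 0` and the sweep from the
left contact for chains with `V_k'' ≠ 0`. Cell chains have `V_k'' = 1 + 3[c k]βr² > 0`, whence
`cellChain_corrector_nondegenerate` (were both taps of a `C²` solution of `L u = -J_tot` silent, `u + X`
would be a first integral of the closed chain blind to `p_0`, contradicting `∂_{p_{N-1}}(u + X) =
(N-1)p_{N-1}`) and the registered form (vanishing `L²` taps are silent by continuity).
-/

noncomputable section

open MeasureTheory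

namespace Summit.AtomisticToContinuum.FouriersLaw.Theorems.MatthiessenLadder.PrefixIncrementBoundsTap

open Literature.MathematicalPhysics.KineticTheory.HeatConduction
open Summit.AtomisticToContinuum.FouriersLaw.Cruxes.BoundedResponseConverges.TwoScaleGluingLogRigidity.Stubs
open Summit.AtomisticToContinuum.FouriersLaw.Theorems.PrefixSteadyStates.LineRegistered

variable {N : ℕ} {P : SiteChain}

/-- `∂_{p_i} H = p_i` for a site chain. [folklore] -/
theorem siteChain_partialP_hamiltonian (P : SiteChain) (i : Fin N) (z : PhaseSpace N) :
    partialP i (P.hamiltonian N) z = z.2 i :=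
  P.partialP_hamiltonian N z.1 z.2 i

/-- `∂_{q_x} ∂Φ/∂q_k = ∂²Φ/∂q_x∂q_k` (`SiteChain.d2Potential`) for smooth potentials. [folklore] -/
theorem siteChain_partialQ_dPotential (hU : ∀ i n, ContDiff ℝ n (P.U i))
    (hV : ∀ i n, ContDiff ℝ n (P.V i)) (k x : Fin N) (z : PhaseSpace N) :
    partialQ x (fun y : PhaseSpace N => P.dPotential N k y.1) z = P.d2Potential N k x z.1 := by
  have h0 : HasDerivAt (fun s : ℝ => P.dPotential N k (z.1 + s • Pi.single x 1))
      (P.d2Potential N k x z.1) (z.1 x - z.1 x) := by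
    rw [sub_self]
    exact P.hasDerivAt_d2Potential (fun i => (hU i (1 + 1)).deriv'.differentiable one_ne_zero)
      (fun i => (hV i (1 + 1)).deriv'.differentiable one_ne_zero) N z.1 k x
  have h1 := (h0.comp_sub_const (z.1 x) (z.1 x)).deriv
  simp only [add_smul_single_eq_update, add_sub_cancel] at h1
  exact h1

/-- The Hessian of the potential energy is symmetric. [folklore] -/
theorem siteChain_d2Potential_comm (P : SiteChain) (i j : Fin N) (q : Fin N → ℝ) :
    P.d2Potential N i j q = P.d2Potential N j i q := by
  unfold SiteChain.d2Potential
  congr 1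
  · by_cases h : i = j
    · subst h; rfl
    · rw [if_neg h, if_neg (Ne.symm h), mul_zero, mul_zero]
  · refine Finset.sum_congr rfl fun k _ => Finset.sum_congr rfl fun l _ => ?_
    split_ifs <;> ring

section Moment

variable {X : PhaseSpace N → ℝ}
  (hX : X = fun x => (∑ k : Fin N, (k.val : ℝ) * (x.2 k ^ 2 / 2 + P.U k.val (x.1 k))) +
    ∑ k : Fin N, ∑ l : Fin N,
      if l.val = k.val + 1 then ((k.val : ℝ) + 1 / 2) * P.V k.val (x.1 l - x.1 k) else 0)
include hX

/-- `∂_{p_i} X = i · p_i` for the energy first moment `X = Σ_k k·e_k` of a site chain. [folklore] -/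
theorem siteChain_partialP_moment (i : Fin N) (x : PhaseSpace N) :
    partialP i X x = (i.val : ℝ) * x.2 i := by
  subst hX
  unfold partialP
  have h1 : HasDerivAt (fun t : ℝ => ∑ k : Fin N,
      (k.val : ℝ) * ((Function.update x.2 i t k) ^ 2 / 2 + P.U k.val (x.1 k)))
      (∑ k : Fin N, if k = i then (i.val : ℝ) * x.2 i else 0) (x.2 i) := by
    refine HasDerivAt.fun_sum fun k _ => ?_
    by_cases hk : k = i
    · subst hk
      simp only [Function.update_self, if_true]
      exact ((((hasDerivAt_pow 2 (x.2 k)).div_const 2).add_const _).const_mul _).congr_deriv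
        (by push_cast; ring)
    · simp only [Function.update_of_ne hk, hk, if_false]
      exact hasDerivAt_const _ _
  have h := h1.add_const (∑ k : Fin N, ∑ l : Fin N,
    if l.val = k.val + 1 then ((k.val : ℝ) + 1 / 2) * P.V k.val (x.1 l - x.1 k) else 0)
  simp only [Finset.sum_ite_eq', Finset.mem_univ, if_true] at h
  exact h.deriv

/-- **`{H, X} = J_tot` for a site chain**: the bracket of the Hamiltonian with the energy first
moment is the total current `Σ_i j_i` (local energy balance summed by parts, free ends). [folklore] -/
theorem siteChain_poisson_hamiltonian_moment (hU : ∀ i n, ContDiff ℝ n (P.U i))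
    (hV : ∀ i n, ContDiff ℝ n (P.V i)) (x : PhaseSpace N) :
    poisson (P.hamiltonian N) X x = ∑ i : Fin N, P.bondCurrent N i x := by
  have hUd : ∀ i, Differentiable ℝ (P.U i) := fun i => (hU i 1).differentiable one_ne_zero
  have hVd : ∀ i, Differentiable ℝ (P.V i) := fun i => (hV i 1).differentiable one_ne_zero
  -- `∂_{q_i} X = i·U_i'(q_i) + Σ_{l = k+1} (k + ½) V_k'(q_l - q_k) ([l = i] - [k = i])`
  have hQ : ∀ i : Fin N, partialQ i X x = (i.val : ℝ) * deriv (P.U i.val) (x.1 i) +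
      ∑ k : Fin N, ∑ l : Fin N, if l.val = k.val + 1 then
        ((k.val : ℝ) + 1 / 2) * deriv (P.V k.val) (x.1 l - x.1 k) *
          ((if l = i then 1 else 0) - (if k = i then 1 else 0)) else 0 := by
    intro i
    subst hX
    unfold partialQ
    have hc : ∀ m : Fin N, HasDerivAt (fun t => Function.update x.1 i t m)
        (if m = i then 1 else 0) (x.1 i) := fun m => by
      simpa [Pi.single_apply] using (hasDerivAt_pi.1 (hasDerivAt_update x.1 i (x.1 i))) m
    have h1 : HasDerivAt (fun t : ℝ => ∑ k : Fin N,
        (k.val : ℝ) * (x.2 k ^ 2 / 2 + P.U k.val (Function.update x.1 i t k)))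
        (∑ k : Fin N, (k.val : ℝ) * (deriv (P.U k.val) (x.1 k) * (if k = i then 1 else 0)))
        (x.1 i) := by
      refine HasDerivAt.fun_sum fun k _ => ?_
      have h := (((hUd k.val _).hasDerivAt).comp (x.1 i) (hc k)).const_add (x.2 k ^ 2 / 2)
      rw [Function.update_eq_self] at h
      exact h.const_mul _
    have h2 : HasDerivAt (fun t : ℝ => ∑ k : Fin N, ∑ l : Fin N,
        if l.val = k.val + 1 then ((k.val : ℝ) + 1 / 2) * P.V k.val (Function.update x.1 i t l -
          Function.update x.1 i t k) else 0)
        (∑ k : Fin N, ∑ l : Fin N, if l.val = k.val + 1 then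
          ((k.val : ℝ) + 1 / 2) * deriv (P.V k.val) (x.1 l - x.1 k) *
            ((if l = i then 1 else 0) - (if k = i then 1 else 0)) else 0) (x.1 i) := by
      refine HasDerivAt.fun_sum fun k _ => HasDerivAt.fun_sum fun l _ => ?_
      by_cases hlk : l.val = k.val + 1
      · simp only [hlk, if_true]
        have ha : HasDerivAt (fun t => Function.update x.1 i t l - Function.update x.1 i t k)
            ((if l = i then 1 else 0) - (if k = i then 1 else 0)) (x.1 i) := (hc l).sub (hc k)
        have hcomp := ((hVd k.val _).hasDerivAt).comp (x.1 i) ha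
        rw [Function.update_eq_self] at hcomp
        have := hcomp.const_mul ((k.val : ℝ) + 1 / 2)
        rw [← mul_assoc] at this
        exact this
      · simp only [hlk, if_false]
        exact hasDerivAt_const _ _
    have h := h1.add h2
    simp only [mul_ite, mul_one, mul_zero, Finset.sum_ite_eq', Finset.mem_univ, if_true] at h
    exact h.deriv
  unfold poisson
  simp only [siteChain_partialP_hamiltonian, P.partialQ_hamiltonian_eq_dPotential hUd hVd,
    siteChain_partialP_moment hX, hQ]
  -- pointwise form of the summand: the pinning terms cancel, the bond terms combine
  have key : ∀ i : Fin N,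
      x.2 i * ((i.val : ℝ) * deriv (P.U i.val) (x.1 i) + ∑ k : Fin N, ∑ l : Fin N,
        (if l.val = k.val + 1 then ((k.val : ℝ) + 1 / 2) * deriv (P.V k.val) (x.1 l - x.1 k) *
          ((if l = i then 1 else 0) - (if k = i then 1 else 0)) else 0)) -
        P.dPotential N i x.1 * ((i.val : ℝ) * x.2 i) =
        ∑ k : Fin N, ∑ l : Fin N, if l.val = k.val + 1 then
          x.2 i * deriv (P.V k.val) (x.1 l - x.1 k) * (((k.val : ℝ) + 1 / 2 - i.val) *
            ((if l = i then 1 else 0) - (if k = i then 1 else 0))) else 0 := by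
    intro i
    unfold SiteChain.dPotential
    set A := ∑ k : Fin N, ∑ l : Fin N, (if l.val = k.val + 1 then
      ((k.val : ℝ) + 1 / 2) * deriv (P.V k.val) (x.1 l - x.1 k) *
        ((if l = i then 1 else 0) - (if k = i then 1 else 0)) else 0) with hA
    set B := ∑ k : Fin N, ∑ l : Fin N, (if l.val = k.val + 1 then
      deriv (P.V k.val) (x.1 l - x.1 k) * ((if l = i then 1 else 0) - (if k = i then 1 else 0))
        else 0) with hB
    have h1 : x.2 i * ((i.val : ℝ) * deriv (P.U i.val) (x.1 i) + A) -
        (deriv (P.U i.val) (x.1 i) + B) * ((i.val : ℝ) * x.2 i) =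
          x.2 i * A - ((i.val : ℝ) * x.2 i) * B := by ring
    rw [h1, hA, hB, Finset.mul_sum, Finset.mul_sum, ← Finset.sum_sub_distrib]
    refine Finset.sum_congr rfl fun k _ => ?_
    rw [Finset.mul_sum, Finset.mul_sum, ← Finset.sum_sub_distrib]
    refine Finset.sum_congr rfl fun l _ => ?_
    split_ifs <;> ring
  simp only [key]
  -- exchange the sums: `∑_i ∑_k ∑_l = ∑_k ∑_l ∑_i`
  rw [Finset.sum_comm]
  refine Finset.sum_congr rfl fun k _ => ?_
  rw [Finset.sum_comm]
  unfold SiteChain.bondCurrent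
  refine Finset.sum_congr rfl fun l _ => ?_
  rw [Finset.sum_ite_irrel, Finset.sum_const_zero]
  split_ifs with hlk
  · have hl : ((l.val : ℕ) : ℝ) = (k.val : ℝ) + 1 := by exact_mod_cast hlk
    simp only [mul_sub, Finset.sum_sub_distrib, mul_ite, mul_one, mul_zero,
      Finset.sum_ite_eq, Finset.mem_univ, if_true]
    rw [hl]
    ring
  · rfl

/-- The energy first moment of a site chain is as smooth as the potentials. [folklore] -/
theorem siteChain_contDiff_moment (hU : ∀ i n, ContDiff ℝ n (P.U i))
    (hV : ∀ i n, ContDiff ℝ n (P.V i)) {n : WithTop ℕ∞} : ContDiff ℝ n X := by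
  subst hX
  have hq : ∀ i : Fin N, ContDiff ℝ n fun x : PhaseSpace N => x.1 i := fun i =>
    (contDiff_apply ℝ ℝ i).comp contDiff_fst
  have hp : ∀ i : Fin N, ContDiff ℝ n fun x : PhaseSpace N => x.2 i := fun i =>
    (contDiff_apply ℝ ℝ i).comp contDiff_snd
  refine (ContDiff.sum fun k _ => contDiff_const.mul ((((hp k).pow 2).div_const 2).add
    ((hU k.val n).comp (hq k)))).add (ContDiff.sum fun k _ => ContDiff.sum fun l _ => ?_)
  by_cases h : l.val = k.val + 1
  · simp only [h, if_true]
    exact contDiff_const.mul ((hV k.val n).comp ((hq l).sub (hq k)))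
  · simp only [h, if_false]
    exact contDiff_const

end Moment

/-- With both contact derivatives silent, the generator of a site chain is the Liouvillian. [folklore] -/
theorem siteChain_generator_eq_poisson (P : SiteChain) (T_L T_R : ℝ) {u : PhaseSpace N → ℝ}
    (hb : ∀ i : Fin N, i.val = 0 ∨ i.val = N - 1 → partialP i u = fun _ => 0) (x : PhaseSpace N) :
    P.generator N T_L T_R u x = poisson (P.hamiltonian N) u x := by
  unfold SiteChain.generator poisson
  simp only [siteChain_partialP_hamiltonian]
  rw [add_eq_left]
  refine mul_eq_zero_of_right _ (Finset.sum_eq_zero fun i _ => ?_)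
  split_ifs with h₁ h₂ h₂
  · simp only [hb i (Or.inl h₁), partialP_const, mul_zero, sub_zero, add_zero]
  · simp only [hb i (Or.inl h₁), partialP_const, mul_zero, sub_zero, add_zero]
  · simp only [hb i (Or.inr h₂), partialP_const, mul_zero, sub_zero, zero_add]
  · rw [add_zero]

section Rigidity

variable (hU : ∀ i n, ContDiff ℝ n (P.U i)) (hV : ∀ i n, ContDiff ℝ n (P.V i))
  {w : PhaseSpace N → ℝ} (hw : ContDiff ℝ 2 w) (hHw : ∀ z, poisson (P.hamiltonian N) w z = 0)
include hU hV hw hHw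

/-- **Recursion B**: for a `C²` first integral `w` of the isolated chain, `∂_{p_k} w ≡ 0 ⇒ ∂_{q_k} w ≡ 0`
(Jacobi with `q_k`: `{w, {H, q_k}} = {w, p_k} = -∂_{q_k} w`). [folklore] -/
theorem siteChain_partialQ_eq_zero_of_partialP_eq_zero (k : Fin N) (hp : ∀ z, partialP k w z = 0)
    (z : PhaseSpace N) : partialQ k w z = 0 := by
  have hj := poisson_jacobi hw (P.contDiff_hamiltonian N (fun i => hU i 2) (fun i => hV i 2))
    (contDiff_position k (n := 2)) z
  have e1 : poisson (P.hamiltonian N) (fun z : PhaseSpace N => z.1 k) = fun z : PhaseSpace N => z.2 k :=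
    funext fun y => by rw [poisson_position_right, siteChain_partialP_hamiltonian]
  rw [e1, poisson_momentum_right, poisson_eq_zero_of_right_eq_zero _ fun y => by
      rw [poisson_antisymm, poisson_position_right, hp, neg_zero],
    poisson_eq_zero_of_right_eq_zero _ fun y => by rw [poisson_antisymm, hHw, neg_zero]] at hj
  linarith

/-- **Recursion A** (`V_k'' ≠ 0`): if `∂_{q_k} w ≡ 0` and `∂_{p_j} w ≡ 0` for all `j ≤ k`, then
`∂_{p_{k+1}} w ≡ 0` (Jacobi with `p_k`: `{w, {H, p_k}} = V_k''(q_{k+1} - q_k) ∂_{p_{k+1}} w`). [folklore] -/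
theorem siteChain_partialP_succ_eq_zero (hV2 : ∀ k r, deriv (deriv (P.V k)) r ≠ 0) (k x : Fin N)
    (hx : x.val = k.val + 1) (hq : ∀ z, partialQ k w z = 0)
    (hp : ∀ j : Fin N, j.val ≤ k.val → ∀ z, partialP j w z = 0) (z : PhaseSpace N) :
    partialP x w z = 0 := by
  have hUd : ∀ i, Differentiable ℝ (P.U i) := fun i => (hU i 1).differentiable one_ne_zero
  have hVd : ∀ i, Differentiable ℝ (P.V i) := fun i => (hV i 1).differentiable one_ne_zero
  have hj := poisson_jacobi hw (P.contDiff_hamiltonian N (fun i => hU i 2) (fun i => hV i 2))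
    (contDiff_momentum k (n := 2)) z
  set G : PhaseSpace N → ℝ := fun y => P.dPotential N k y.1 with hG
  have e1 : poisson (P.hamiltonian N) (fun z : PhaseSpace N => z.2 k) = fun y => -G y :=
    funext fun y => by rw [poisson_momentum_right, P.partialQ_hamiltonian_eq_dPotential hUd hVd]
  have e2 : ∀ y, poisson (fun z : PhaseSpace N => z.2 k) w y = 0 := fun y => by
    rw [poisson_antisymm, poisson_momentum_right, hq, neg_zero, neg_zero]
  have e3 : ∀ y, poisson w (P.hamiltonian N) y = 0 := fun y => by rw [poisson_antisymm, hHw, neg_zero]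
  rw [e1, poisson_neg_right, poisson_eq_zero_of_right_eq_zero _ e2,
    poisson_eq_zero_of_right_eq_zero _ e3, add_zero, add_zero, neg_eq_zero] at hj
  -- expand `{w, G} = Σ_i ∂_{p_i} w ∂_{q_i} G` (`∂_{p_i} G = 0`) and isolate `i = x`
  unfold poisson at hj
  simp only [hG, partialP_of_fst, mul_zero, sub_zero, siteChain_partialQ_dPotential hU hV k] at hj
  rw [Finset.sum_eq_single x, siteChain_d2Potential_comm, P.d2Potential_succ N hx, mul_neg,
    neg_eq_zero] at hj
  · exact (mul_eq_zero.1 hj).resolve_right (hV2 k.val _)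
  · intro i _ hix
    by_cases hik : i.val ≤ k.val
    · rw [hp i hik, zero_mul]
    · have h2 : k.val + 2 ≤ i.val := by
        have h3 : i.val ≠ k.val + 1 := fun e => hix (Fin.ext (e.trans hx.symm))
        omega
      rw [siteChain_d2Potential_comm, P.d2Potential_eq_zero_of_le N h2, mul_zero]
  · exact fun h => absurd (Finset.mem_univ x) h

/-- **First-integral rigidity of the closed chain** (`V_k'' ≠ 0` on every bond): a `C²` first integral
of the isolated chain blind to the left contact momentum `p_0` has ALL coordinate derivatives zero
(recursions A and B swept from the left end). [folklore] -/
theorem siteChain_poisson_hamiltonian_rigidity (hV2 : ∀ k r, deriv (deriv (P.V k)) r ≠ 0)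
    (h0 : ∀ i : Fin N, i.val = 0 → ∀ z, partialP i w z = 0) (i : Fin N) :
    (∀ z, partialP i w z = 0) ∧ ∀ z, partialQ i w z = 0 := by
  suffices key : ∀ n : ℕ, ∀ i : Fin N, i.val < n →
      (∀ z, partialP i w z = 0) ∧ ∀ z, partialQ i w z = 0 from key _ i i.isLt
  intro n
  induction n with
  | zero => exact fun i hi => absurd hi (Nat.not_lt_zero _)
  | succ n ih =>
    intro i hi
    by_cases hlt : i.val < n
    · exact ih i hlt
    have heq : i.val = n := by omega
    have hP : ∀ z, partialP i w z = 0 := by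
      rcases Nat.eq_zero_or_pos n with hn | hn
      · exact h0 i (heq.trans hn)
      · exact siteChain_partialP_succ_eq_zero hU hV hw hHw hV2 ⟨n - 1, by omega⟩ i
          (by show i.val = n - 1 + 1; omega) (ih _ (by show n - 1 < n; omega)).2
          fun j hj => (ih j (by change j.val ≤ n - 1 at hj; omega)).1
    exact ⟨hP, siteChain_partialQ_eq_zero_of_partialP_eq_zero hU hV hw hHw i hP⟩

end Rigidity

/-- `V_i'' = 1 + 3 β_i r²` for the cell chain (`β_i = β` at a cell, `0` elsewhere). [folklore] -/
theorem cellChain_deriv_deriv_V (ω₂ lam β γ : ℝ) (c : ℕ → Bool) (i : ℕ) (r : ℝ) :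
    deriv (deriv ((cellChain ω₂ lam β γ c).V i)) r = 1 + 3 * (if c i then β else 0) * r ^ 2 := by
  rw [show deriv ((cellChain ω₂ lam β γ c).V i) = fun r => r + (if c i then β else 0) * r ^ 3 from
    funext (cellChain_deriv_V ω₂ lam β γ c i)]
  exact (((hasDerivAt_id' r).add ((hasDerivAt_pow 3 r).const_mul _)).congr_deriv
    (by push_cast; ring)).deriv

/-- **Non-degeneracy of the Kubo corrector of a cell chain** (`β ≥ 0`, any `c, ω₂, lam, γ, T_L, T_R`,
`N ≥ 2`): a `C²` solution `u` of the corrector equation `L u = -J_tot` cannot have both contact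
momentum derivatives identically zero — otherwise `u + X` (`{H, X} = J_tot`) is a `C²` first integral
of the closed chain blind to `p_0`, contradicting `∂_{p_{N-1}}(u + X) = (N-1) p_{N-1}`. [folklore] -/
theorem cellChain_corrector_nondegenerate {ω₂ lam β : ℝ} (hβ : 0 ≤ β) (γ : ℝ) (c : ℕ → Bool)
    (T_L T_R : ℝ) (hN : 2 ≤ N) {u : PhaseSpace N → ℝ} (hu : ContDiff ℝ 2 u)
    (hLu : ∀ x, (cellChain ω₂ lam β γ c).generator N T_L T_R u x =
      -∑ i : Fin N, (cellChain ω₂ lam β γ c).bondCurrent N i x)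
    (b₀ b₁ : Fin N) (hb₀ : b₀.val = 0) (hb₁ : b₁.val = N - 1)
    (h0 : ∀ x, partialP b₀ u x = 0) (h1 : ∀ x, partialP b₁ u x = 0) : False := by
  set P := cellChain ω₂ lam β γ c with hP
  have hU : ∀ i n, ContDiff ℝ n (P.U i) := fun i n => cellChain_contDiff_U ω₂ lam β γ c i
  have hV : ∀ i n, ContDiff ℝ n (P.V i) := fun i n => cellChain_contDiff_V ω₂ lam β γ c i
  have hV2 : ∀ k r, deriv (deriv (P.V k)) r ≠ 0 := fun k r => by
    rw [hP, cellChain_deriv_deriv_V]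
    have := mul_nonneg (mul_nonneg zero_le_three (ite_amplitude_nonneg hβ (c k))) (sq_nonneg r)
    exact ne_of_gt (by linarith)
  have hud : Differentiable ℝ u := hu.differentiable (by norm_num)
  -- the energy first moment `X = Σ_k k e_k` of the cell chain
  set X : PhaseSpace N → ℝ := fun x =>
    (∑ k : Fin N, (k.val : ℝ) * (x.2 k ^ 2 / 2 + P.U k.val (x.1 k))) +
      ∑ k : Fin N, ∑ l : Fin N,
        if l.val = k.val + 1 then ((k.val : ℝ) + 1 / 2) * P.V k.val (x.1 l - x.1 k) else 0 with hX
  have hXs : ContDiff ℝ 2 X := siteChain_contDiff_moment hX hU hV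
  have hXd : Differentiable ℝ X := hXs.differentiable (by norm_num)
  have hw : ContDiff ℝ 2 (u + X) := hu.add hXs
  have hb : ∀ i : Fin N, i.val = 0 ∨ i.val = N - 1 → partialP i u = fun _ => 0 := by
    rintro i (hi | hi)
    · rw [show i = b₀ from Fin.ext (hi.trans hb₀.symm)]; exact funext h0
    · rw [show i = b₁ from Fin.ext (hi.trans hb₁.symm)]; exact funext h1
  -- `{H, u + X} = 0`
  have hHw : ∀ x, poisson (P.hamiltonian N) (u + X) x = 0 := fun x => by
    rw [poisson_add_right _ hud hXd, ← siteChain_generator_eq_poisson P T_L T_R hb x, hLu x,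
      siteChain_poisson_hamiltonian_moment hX hU hV]
    ring
  have hw0 : ∀ i : Fin N, i.val = 0 → ∀ z, partialP i (u + X) z = 0 := fun i hi z => by
    rw [partialP_add hud hXd, siteChain_partialP_moment hX, congrFun (hb i (Or.inl hi)) z, hi]
    simp
  -- rigidity: `∂_{p_{N-1}} (u + X) = 0` at the point `q = 0`, `p = 1`
  have key := (siteChain_poisson_hamiltonian_rigidity hU hV hw hHw hV2 hw0 b₁).1
    ((fun _ => 0, fun _ => 1) : PhaseSpace N)
  rw [partialP_add hud hXd, h1, siteChain_partialP_moment hX, zero_add, hb₁] at key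
  simp only [mul_one] at key
  have hc : (N - 1 : ℕ) = 0 := by exact_mod_cast key
  omega

/-- **Stub `stub_cellChainTapEnergyPos` — STRICTLY POSITIVE TAP ENERGY OF THE KUBO CORRECTOR OF A
CELL CHAIN.** For ANY cell profile `c`, `β ≥ 0` (so `V_i'' = 1 + 3[c i]βr² > 0`), `N ≥ 2`, any bath
temperatures and any `T`: a `C²` solution `u` of the corrector equation `L_{T_L,T_R} u = -J_tot` whose
contact taps are square-integrable against the Gibbs weight `e^{-H/T}dx` has
`∫ (∂_{p_0}u)² e^{-H/T}dx + ∫ (∂_{p_{N-1}}u)² e^{-H/T}dx > 0` (contact sites by value): were the sum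
zero, both continuous integrands would vanish a.e. for a measure dominating Lebesgue measure, hence
everywhere, contradicting `cellChain_corrector_nondegenerate`. [folklore] -/
theorem stub_cellChainTapEnergyPos :
    ∀ (ω₂ lam β γ T_L T_R T : ℝ), 0 ≤ β → ∀ (c : ℕ → Bool) (N : ℕ), 2 ≤ N →
      ∀ u : PhaseSpace N → ℝ, ContDiff ℝ 2 u →
      (∀ x, (cellChain ω₂ lam β γ c).generator N T_L T_R u x =
        -∑ i : Fin N, (cellChain ω₂ lam β γ c).bondCurrent N i x) →
      ∀ b₀ b₁ : Fin N, b₀.val = 0 → b₁.val = N - 1 →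
      MeasureTheory.Integrable (fun x => (partialP b₀ u x) ^ 2)
        ((MeasureTheory.volume : MeasureTheory.Measure (PhaseSpace N)).withDensity fun x =>
          ENNReal.ofReal (Real.exp (-((cellChain ω₂ lam β γ c).hamiltonian N x) / T))) →
      MeasureTheory.Integrable (fun x => (partialP b₁ u x) ^ 2)
        ((MeasureTheory.volume : MeasureTheory.Measure (PhaseSpace N)).withDensity fun x =>
          ENNReal.ofReal (Real.exp (-((cellChain ω₂ lam β γ c).hamiltonian N x) / T))) →
      0 < (∫ x, (partialP b₀ u x) ^ 2
          ∂((MeasureTheory.volume : MeasureTheory.Measure (PhaseSpace N)).withDensity fun x =>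
            ENNReal.ofReal (Real.exp (-((cellChain ω₂ lam β γ c).hamiltonian N x) / T)))) +
        ∫ x, (partialP b₁ u x) ^ 2
          ∂((MeasureTheory.volume : MeasureTheory.Measure (PhaseSpace N)).withDensity fun x =>
            ENNReal.ofReal (Real.exp (-((cellChain ω₂ lam β γ c).hamiltonian N x) / T))) := by
  intro ω₂ lam β γ T_L T_R T hβ c N hN u hu hLu b₀ b₁ hb₀ hb₁ hi₀ hi₁
  haveI := isAddHaarMeasure_volume_phaseSpace N
  set μ : Measure (PhaseSpace N) := (volume : Measure (PhaseSpace N)).withDensity fun x =>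
    ENNReal.ofReal (Real.exp (-((cellChain ω₂ lam β γ c).hamiltonian N x) / T)) with hμ
  have hac : (volume : Measure (PhaseSpace N)) ≪ μ :=
    withDensity_absolutelyContinuous'
      (((cellChain_continuous_hamiltonian ω₂ lam β γ c N).neg.div_const T).rexp.measurable
        |>.ennreal_ofReal.aemeasurable)
      (Filter.Eventually.of_forall fun x => (ENNReal.ofReal_pos.2 (Real.exp_pos _)).ne')
  -- a vanishing tap energy makes the (continuous) tap vanish identically
  have hzero : ∀ b : Fin N, Integrable (fun x => (partialP b u x) ^ 2) μ →
      ∫ x, (partialP b u x) ^ 2 ∂μ = 0 → ∀ x, partialP b u x = 0 := fun b hib hI x => by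
    have hae : (fun x => (partialP b u x) ^ 2) =ᵐ[volume] fun _ => (0 : ℝ) :=
      hac.ae_eq ((integral_eq_zero_iff_of_nonneg (fun x => sq_nonneg _) hib).1 hI)
    simpa using congrFun ((((continuous_partialP hu (by norm_num) b).pow 2).ae_eq_iff_eq volume
      continuous_const).1 hae) x
  have hn₀ : 0 ≤ ∫ x, (partialP b₀ u x) ^ 2 ∂μ := integral_nonneg fun x => sq_nonneg _
  have hn₁ : 0 ≤ ∫ x, (partialP b₁ u x) ^ 2 ∂μ := integral_nonneg fun x => sq_nonneg _
  by_contra h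
  exact cellChain_corrector_nondegenerate hβ γ c T_L T_R hN hu hLu b₀ b₁ hb₀ hb₁
    (hzero b₀ hi₀ (by linarith)) (hzero b₁ hi₁ (by linarith))

end Summit.AtomisticToContinuum.FouriersLaw.Theorems.MatthiessenLadder.PrefixIncrementBoundsTap

end
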